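import Summits.QuantumFields.BalabanUV.Beta.FP.RemainderSymbolSlice

/-!
# `BalabanUV.Beta.FP.PerfectPropagatorRemainderSymbol` — road «FP» for binder row D1, leaf H2-P, row H2-P-B at THE CONTINUUM (1.66) WEIGHTS `Re W_∞`:
# the remainder symbol `B = PinfSym − |p̂|⁻²𝟙` of the UNCONSTRAINED PERFECT PROPAGATOR along a coordinate slice — `RemainderSymbolSlice` with the
# invertibility and coercive-inverse rows DISCHARGED (`isUnit_det_feynMat`, `norm_PinfSym_d1Sym_le_inv_norm_sq`), the two H2-P-REG R2 weight rows displayed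

HONEST DEPENDENCY (page 1, mandatory): continuum YM on T⁴ ⇐ BetaPertH ∧ nine spine estimates (0/9 proved); BetaPertH ⇐ (D1) ∧ (D4) ∧ CAP+tail;
G-an2-4 gates asym, D1 and NE2/3/4.  HONEST FRAMING (cell contract, verbatim): «discharging `BetaPertH` makes Bałaban's UV stability UNCONDITIONAL —
a real constructive-QFT result; it is NOT the continuum limit and NOT the Clay problem.»  THIS MODULE DISCHARGES NOTHING of the wall: [our object] instantiation of
`FP/RemainderSymbolSlice` (p235721) at `w := Re W_∞` with `FP/PerfectPropagatorSymbol.isUnit_det_feynMat` (p231001) and `FP/PerfectPropagatorBound` (p232695); the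
REGULARITY ROWS of `Re W_∞` (slice `C³`, `Re W_∞ − 1` graded `O(‖s‖^{2−n})`) remain DISPLAYED HYPOTHESES `hwC`, `hw` — they are H2-P-REG R2 (gan24-p3-g16, from
W166-HOLO (D)/(E) p234903/p235467 + W166-FLAT p232933), NOT proved here.  One reducible abbreviation `wInf` (the literal weight of `PinfSym`); no `def … : Prop`, nothing cited; 0 sorry; 0 wall binders; NOT D1, NOT BetaPertH,
NOT continuum, NOT Clay.

ABSOLUTE RULE (cell charter, verbatim): «No internally-minted statement may enter as a cited fact. Every hypothesis is either kernel-proved in this package or a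
verbatim quotation of a PUBLISHED theorem with page reference. The manuscript(s) under audit are NOT citable for their own disputed steps — they are the thing
under adjudication; programme-internal (2001/route/tribunal) claims are never citable.»

WHAT (`wInf μ ν s := (W166Inf μ ν (ofRealVec s)).re` — a reducible abbreviation, lattice dimension `d + 1`; base point `s`, direction `i`, `t ∈ [−π,π]`, transverse part `q = i.removeNth s ∈ BZ d`,
`q ≠ 0`, `p := update s i t`):
* `remSl0_wInf_eq` — `remSl0 wInf s i α β t = PinfSym p (p̂ p) α β − [α = β]∕Σ‖p̂ p‖²` (the row's `B`);
* `hasDerivAt_remSl_wInf` — the chain `(remSl_k)′ = remSl_{k+1}` (k < 3) at `t`, given the slice-`C³` row `hwC`;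
* **`norm_remSl_wInf_le`** — under `hwC` and `hw` (R2's rows) and `π ≤ M`: `‖remSl_k wInf s i α β t‖ ≤ 3^k·K·c∕‖p‖ᵏ` (k ≤ 3) with the constants of
  `RemainderSymbolSlice.norm_remSl_le` at `cinv := (π²∕4)^{d+4}` — `∂_tᵏ B = O(‖s‖^{−k})` on the punctured zone.  With `PuncturedCoordDeriv` §3 (`α = k < 4 = d+1` at
  d = 3) this is `∂ᵏB ∈ L¹(BZ 4)`; with §4 the kernel rate `O(‖z‖_∞^{−3})` (H2-P-KER-ASM, owner).
Provenance: G-an2-4 swarm leaf prover 05, gen 34 (prover-b2b-balaban-gan24-formalise-leaf-05-g34-0), cross-lane on road FP (row H2-P-B claim l.20249, owner GO l.20595), 2026-08-20.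

v1.1 NOTE (docstring only; gen 35, located issue CLAIMS l.21819 ∕ owner finding F-FP-5-1 l.21879): the displayed slice-`C³` row `hwC` of `hasDerivAt_remSl_wInf` ∕
`norm_remSl_wInf_le` is R1's GLOBAL currency `∀ p μ ν, ContDiff ℝ 3 (u ↦ Re W_∞(update p i u))`, which the Lean object `W166Inf` does NOT satisfy (unremoved removable
singularities at real momenta in `2πℤ ∖ {0}`, outside the zone — gan24-p3-g16, CLAIMS l.20785), and which H2-P-REG R2 (`FP/PerfectSymbolDeriv`, LOCAL on
`Ioo (−(π+δ₁₆₆)) (π+δ₁₆₆)`) cannot discharge: the theorems here are true implications whose `hwC` premise is not instantiable.  THE UNCONDITIONAL VERSIONS are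
`FP/PerfectRemainderSliceLocal.hasDerivAt_remSl0∕1∕2_wInf_U` (links on the whole open interval, `hdet_wInf_U`) and
`FP/PerfectRemainderSliceLocalLetters.norm_remSl_wInf_le_local` (`‖remSl_k‖ ≤ 3ᵏ·Krem d∕‖p‖ᵏ`, every hypothesis a slice position), p238395 ∕ p238536; the every-order
chain is d1-formalise-leaf-01's `FP/PerfectPropagatorRemainderSymbolN` (p238623).  `hdet_wInf`, `hinv_wInf`, `slicePt`, `remSl0_wInf_eq` are unaffected and in use.
-/

noncomputable section

namespace Summit.QuantumFields.BalabanUV.Beta.FP.PerfectPropagatorRemainderSymbol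

open Matrix
open scoped Matrix.Norms.Operator BigOperators
open Literature.MathematicalPhysics.QuantumFieldTheory.Balaban1983to89
open B4Strip (ofRealVec)
open B4ContourShift (BZ)
open B5Prop11Fiber (d1Sym)
open Summit.QuantumFields.BalabanUV.Beta.FP.PerfectSymbol166 (W166Inf)
open Summit.QuantumFields.BalabanUV.Beta.FP.PerfectPropagatorSymbol (feynMat PinfSym isUnit_det_feynMat)
open Summit.QuantumFields.BalabanUV.Beta.FP.PerfectPropagatorBound (d1Sym_ne_zero norm_PinfSym_d1Sym_le_inv_norm_sq)
open Summit.QuantumFields.BalabanUV.Beta.FP.RemainderSymbolSlice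

variable {d : ℕ}

/-- [our object] the continuum (1.66) weights read on real momenta: `wInf μ ν s := Re W_∞(μ,ν; s)` (reducible abbreviation). -/
abbrev wInf (μ ν : Fin (d + 1)) (s : Fin (d + 1) → ℝ) : ℝ := (W166Inf μ ν (ofRealVec s)).re

/-- [folklore] membership ∕ non-vanishing ∕ norm facts of the slice point (re-export of `RemainderSymbolSlice.slicePt_facts`). -/
theorem slicePt {s : Fin (d + 1) → ℝ} {i : Fin (d + 1)} {t : ℝ} (ht : t ∈ Set.Icc (-Real.pi) Real.pi)
    (hq : i.removeNth s ∈ BZ d) (hq0 : i.removeNth s ≠ 0) :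
    Function.update s i t ∈ BZ (d + 1) ∧ Function.update s i t ≠ 0 := by
  obtain ⟨h1, h2, -, -⟩ := slicePt_facts ht hq hq0 (s := s) (i := i)
  exact ⟨h1, h2⟩

/-- [our object] the invertibility row DISCHARGED at `Re W_∞`: off the origin of the zone the Feynman-completed perfect symbol has a unit determinant. -/
theorem hdet_wInf : ∀ p ∈ BZ (d + 1), p ≠ 0 →
    IsUnit (feynMat (fun μ ν => wInf μ ν p) (d1Sym p)).det :=
  fun _ hp hp0 => isUnit_det_feynMat hp (d1Sym_ne_zero hp hp0)

/-- [our object] the coercive-inverse row DISCHARGED at `Re W_∞` (`PinfSym` is this inverse by definition): `‖(feynMat (Re W_∞ p) (p̂ p))⁻¹ α β‖ ≤ (π²∕4)^{d+4}∕‖p‖²`. -/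
theorem hinv_wInf : ∀ p ∈ BZ (d + 1), p ≠ 0 → ∀ α β : Fin (d + 1),
    ‖(feynMat (fun μ ν => wInf μ ν p) (d1Sym p))⁻¹ α β‖ ≤ (Real.pi ^ 2 / 4) ^ (d + 1 + 3) / ‖p‖ ^ 2 :=
  fun _ hp hp0 α β => norm_PinfSym_d1Sym_le_inv_norm_sq hp hp0 α β

/-- [our object] **THE ROW's `B`**: `remSl0` at the continuum weights is `PinfSym p (p̂ p) α β − [α = β]∕Σ‖p̂ p‖²`, `p = update s i t`. -/
theorem remSl0_wInf_eq {s : Fin (d + 1) → ℝ} {i : Fin (d + 1)} {t : ℝ} (ht : t ∈ Set.Icc (-Real.pi) Real.pi)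
    (hq : i.removeNth s ∈ BZ d) (hq0 : i.removeNth s ≠ 0) (α β : Fin (d + 1)) :
    remSl0 (wInf (d := d)) s i α β t
      = PinfSym (Function.update s i t) (d1Sym (Function.update s i t)) α β
        - (if α = β then ((((∑ a, ‖d1Sym (Function.update s i t) a‖ ^ 2 : ℝ))⁻¹ : ℝ) : ℂ) else 0) := by
  obtain ⟨hmem, hne⟩ := slicePt ht hq hq0
  have hph : 0 < ∑ a, ‖d1Sym (Function.update s i t) a‖ ^ 2 :=
    PerfectPropagatorBound.sum_norm_sq_pos (d1Sym_ne_zero hmem hne)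
  exact remSl0_eq_sub_free (wInf (d := d)) s i α β t (hdet_wInf _ hmem hne) hph

/-- [our object] **THE CHAIN AT THE CONTINUUM WEIGHTS** (slice-`C³` row `hwC` displayed): `(remSl_k)′ = remSl_{k+1}`, `k < 3`, at `t`. -/
theorem hasDerivAt_remSl_wInf {s : Fin (d + 1) → ℝ} {i : Fin (d + 1)} {t : ℝ}
    (hwC : ∀ μ ν, ContDiff ℝ 3 (fun u : ℝ => ((wInf μ ν (Function.update s i u) : ℝ) : ℂ)))
    (ht : t ∈ Set.Icc (-Real.pi) Real.pi) (hq : i.removeNth s ∈ BZ d) (hq0 : i.removeNth s ≠ 0) (α β : Fin (d + 1)) :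
    HasDerivAt (remSl0 (wInf (d := d)) s i α β)
        (remSl1 (wInf (d := d)) s i α β t) t ∧
      HasDerivAt (remSl1 (wInf (d := d)) s i α β)
        (remSl2 (wInf (d := d)) s i α β t) t ∧
      HasDerivAt (remSl2 (wInf (d := d)) s i α β)
        (remSl3 (wInf (d := d)) s i α β t) t := by
  obtain ⟨hmem, hne⟩ := slicePt ht hq hq0
  have hdet := hdet_wInf _ hmem hne
  exact ⟨hasDerivAt_remSl0 (w := wInf (d := d)) hwC hdet hq hq0 α β, hasDerivAt_remSl1 (w := wInf (d := d)) hwC hdet hq hq0 α β,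
    hasDerivAt_remSl2 (w := wInf (d := d)) hwC hdet hq hq0 α β⟩

/-- [our object] **THE GRADED LETTERS AT THE CONTINUUM WEIGHTS** (R2's rows `hwC`, `hw` displayed; `π ≤ M`): with `p := update s i t`,
`‖remSl_k … t‖ ≤ 3^k·K·c∕‖p‖ᵏ` (k ≤ 3), constants of `RemainderSymbolSlice.norm_remSl_le` at `cinv = (π²∕4)^{d+4}`. -/
theorem norm_remSl_wInf_le {s : Fin (d + 1) → ℝ} {i : Fin (d + 1)} {t cw M : ℝ}
    (hwC : ∀ p : Fin (d + 1) → ℝ, ∀ μ ν, ContDiff ℝ 3 (fun u : ℝ => ((wInf μ ν (Function.update p i u) : ℝ) : ℂ)))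
    (hcw : 0 ≤ cw)
    (hw : ∀ p ∈ BZ (d + 1), ∀ μ ν, ∀ n ≤ 3,
      ‖iteratedDeriv n (fun u : ℝ => ((wInf μ ν (Function.update p i u) : ℝ) : ℂ) - 1) (p i)‖ ≤ cw * ‖p‖ ^ (2 - n))
    (hπM : Real.pi ≤ M) (ht : t ∈ Set.Icc (-Real.pi) Real.pi) (hq : i.removeNth s ∈ BZ d) (hq0 : i.removeNth s ≠ 0) (α β : Fin (d + 1)) :
    let n : ℝ := Fintype.card (Fin (d + 1))
    let Cf : ℝ := 128 * ((d + 1 : ℕ) : ℝ) ^ 2 * M ^ 4 * (M ^ 2 * cw + 1) + 8 * M ^ 2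
    let Cx : ℝ := 128 * ((d + 1 : ℕ) : ℝ) ^ 2 * M ^ 6 * cw
    let K : ℝ := n * (RemainderSymbolChain.aSum (n * (Real.pi ^ 2 / 4) ^ (d + 1 + 3)) (n * Cf) (n * Cf) (n * Cf) M * Cx)
    let c : ℝ := RemainderSymbolChain.cSum (4 / Real.pi ^ 2) 2 2 2 M
    let r : ℝ := ‖Function.update s i t‖
    ‖remSl0 (wInf (d := d)) s i α β t‖ ≤ K * c ∧
      ‖remSl1 (wInf (d := d)) s i α β t‖ ≤ 3 * (K * c) / r ∧
      ‖remSl2 (wInf (d := d)) s i α β t‖ ≤ 9 * (K * c) / r ^ 2 ∧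
      ‖remSl3 (wInf (d := d)) s i α β t‖ ≤ 27 * (K * c) / r ^ 3 :=
  norm_remSl_le (w := wInf (d := d)) hwC hcw hw hπM hinv_wInf ht hq hq0 α β

end Summit.QuantumFields.BalabanUV.Beta.FP.PerfectPropagatorRemainderSymbol

end
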